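/-
Copyright: the b2b-balaban T⁴-continuum CRUX team, row NE7b OWNER lineage `t4-ne7b-p1` (gen 135). Project licence.
-/
import Summits.QuantumFields.BalabanUV.T4Continuum.Spine.NE7b.SupRegulatedActivityShift

/-!
# THE TWO-LETTER FORMAT SHIFTS WITHOUT THE RATE DOUBLING — (374)'s OBSTRUCTION IS THE STORED PENALTY, NOT THE ROAD: keep for each cell factor
# the road's TWO primary letters ((290) before its `max`),
#   (S) SMALL FIELDS:  `‖g(ζ)‖ ≤ ε`                 for `Σ_{x∈P}ζ_x² ≤ h²`,
#   (L) LARGE FIELDS:  `‖g(ζ)‖ ≤ M·e^{½κ₀Σ_{x∈P}ζ_x²}`  for all `ζ`     (`κ₀` the SMALL stability rate, `M` a constant, `2` for the road),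
# instead of their one-rate merger `‖g‖ ≤ ε(h)e^{½κΣζ²}` with a stored penalty rate `κ ≥ 2κ₀`.  Then for an external field small on the cell
# (`Σ_Pψ² ≤ Ψ²`, `Ψ ≤ h`) the shifted factor is regulated IN THE FLUCTUATION FIELD with ANY fresh rate `κ ≥ κ₀(1+τ)` — chosen for the CURRENT
# Gaussian, not inherited —
#   `‖g(ω+ψ)‖ ≤ (ε + M·e^{½κ₀(1+τ⁻¹)Ψ²}·e^{−½(κ−κ₀(1+τ))(h−Ψ)²}) · e^{½κΣ_{x∈P}ω_x²}`   for EVERY `ω`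
# (small shifted field: Minkowski `√Σ(ω+ψ)² ≤ √Σω² + Ψ`, so `Σω² ≤ (h−Ψ)²` forces (S) — NO exponential cost in `Ψ`; large: (L) + Young at the
# small rate `κ₀` + conversion of the excess `Σω² > (h−Ψ)²` at the fresh rate).  The window is now `(κ−κ₀(1+τ))(h−Ψ)² ≥ 2log(M∕ε) + κ₀(1+τ⁻¹)Ψ²`:
# a condition on the small-field RADIUS `h` against the fresh `κ` (`h² ≳ κ⁻¹log(M∕ε) ≍ γ_op·log(M∕ε)`: radius ≍ √log × typical fluctuation), with
# NO lower bound of `κ` by an inherited rate — the doubling of (374) is gone; (289)'s activity bound then applies with `(ε_shift, κ)`: SCOPING-d7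
# (α2) (row NE7b, node U5c; (289)∕(292) BY NAME; [folklore])

Cell `pub-balaban`, sub-cell `t4`, spine estimate NE7b (`T4WeightBudget.RelWeightBound`; the cell's OWN estimate — NOT PRINTED in
[Bałaban 1983–89], NOT PROVED).  Crux-route work under `Spine/NE7b/` by the row OWNER (`t4-ne7b-p1` gen 135, file (376)) under FREEZE
(0)'s crux-prover clause, on this gen's SCOPING-d7 (α2); NOTHING of Bałaban's is named as a Lean object, valued or asserted; no `T4Continuum/Support`
leaf typed; no `def`, no notation; zero `sorry`.  Imports (BY NAME): the OWNER's (292) `…SupRegulatedActivityShift` (`sum_add_sq_le`; through it (289)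
`norm_cellActivity_le_of_regulated`, `one_le_regulatorCost`); Mathlib's `Finset.sum_mul_sq_le_sq_mul_sq` (Cauchy–Schwarz), `Real.sqrt_le_sqrt`,
`Real.sq_sqrt`, `Real.sqrt_sq`, `Real.sqrt_mul`, `Real.exp_log`.

WHAT IS PROVED ([folklore]; `Q(ζ) := Σ_{x∈P}ζ_x²` on a cell `P`):
* §1 MINKOWSKI ON A CELL: `sum_add_sq_le_sq_add` (`Q(ω+ψ) ≤ (√Q(ω) + √Q(ψ))²`), **`small_of_shift_small`** (`Q(ψ) ≤ Ψ²`, `Q(ω) ≤ (h−Ψ)²`, `0 ≤ Ψ ≤ h`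
  ⟹ `Q(ω+ψ) ≤ h²`), `large_of_shift_large` (contrapositive: `h² < Q(ω+ψ)` ⟹ `(h−Ψ)² < Q(ω)`);
* §2 THE SHIFTED TWO-LETTER FACTOR IS REGULATED WITH A FRESH RATE: **`twoLetter_shift_regulated`** (displayed), `eps_shift_nonneg`;
* §3 THE WINDOW WITHOUT DOUBLING: **`eps_shift_le_two_eps`** (`(κ−κ₀(1+τ))(h−Ψ)²∕2 ≥ log(M∕ε) + κ₀(1+τ⁻¹)Ψ²∕2` ⟹ `ε_shift ≤ 2ε` — no condition
  relating `κ` to an inherited format rate);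
* §4 THE ACTIVITY LETTER: **`twoLetter_activity_le`** (cells `cell p` pairwise disjoint of `≤ v` sites, every factor two-lettered, the external field
  small on every cell ⟹ `‖∫∏_{p∈K}g_p(ω+ψ)dN(0,Γ)(ω)‖ ≤ (ε_shift·A^v)^{#K}`, `A = (1−θ)^{−κγ∕(2θ)}`, under the FRESH subcriticality `κγ_op ≤ θ`);
  §5 toy.

HONEST (what this is NOT).  One cell ∕ one step of letter bookkeeping; it removes (374)'s doubling but NOT the two remaining located needs of
SCOPING-d7: (α3) NESTING of the small-field regions across scales (`Ψ ≤ h − √(κ⁻¹2log(M∕ε))` per cell for the NEXT field, which a coarse field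
obeys only if it is SMOOTH on the finer cells — the lineage's fibre∕background machinery (56)∕(60)∕(61)∕(270)–(286), not Young), and (α4) the
per-step constants `1 + O(η_j)` of the stability letter after normalising by `Z_0` (vacuum energy), whose product converges iff `η_j` is summable —
CONTRACTION, i.e. extraction of the local relevant parts + rescaling, the renormalisation group proper; scalar skeleton ((A3), NC-NE7b-α UNRULED);
nothing of Bałaban's asserted.  BY-NAME EFFECT ON THE WALL: NONE.  NE7b NOT PRINTED ∕ NOT PROVED; spine PROVED 0∕9; rung (B)+1 — the programme's
measures remain FINITE-torus statements; NOT the mass gap, NOT Clay.  HONEST DEPENDENCY: continuum YM on T⁴ ⇐ BetaPertH ∧ nine spine estimates (0∕9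
proved); BetaPertH ⇐ (D1) ∧ (D4) ∧ CAP+tail; G-an2-4 gates asym, D1 and NE2∕3∕4.
-/

set_option autoImplicit false

noncomputable section

namespace Summit.QuantumFields.BalabanUV.T4Continuum.NE7b.SupTwoLetterShift

open MeasureTheory ProbabilityTheory Finset Real
open scoped BigOperators
open Literature.Probability.LatticeModels (cellActivity)
open SupRegulatedActivityShift (sum_add_sq_le)
open SupRegulatedActivityBound (norm_cellActivity_le_of_regulated one_le_regulatorCost)

variable {ι : Type} [Fintype ι] [DecidableEq ι] {V : Type*}

/-! ## §1. Minkowski on a cell -/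

omit [Fintype ι] [DecidableEq ι] in
/-- **MINKOWSKI ON A CELL**: `Σ_{x∈P}(a_x + b_x)² ≤ (√Σa² + √Σb²)²` (Cauchy–Schwarz on the cross term). [folklore] -/
theorem sum_add_sq_le_sq_add (P : Finset ι) (a b : ι → ℝ) :
    ∑ x ∈ P, (a x + b x) ^ 2 ≤ (Real.sqrt (∑ x ∈ P, a x ^ 2) + Real.sqrt (∑ x ∈ P, b x ^ 2)) ^ 2 := by
  set A := ∑ x ∈ P, a x ^ 2 with hA
  set B := ∑ x ∈ P, b x ^ 2 with hB
  have hA0 : 0 ≤ A := sum_nonneg fun x _ => sq_nonneg (a x)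
  have hB0 : 0 ≤ B := sum_nonneg fun x _ => sq_nonneg (b x)
  have hcs : (∑ x ∈ P, a x * b x) ^ 2 ≤ A * B := sum_mul_sq_le_sq_mul_sq P a b
  have hcross : ∑ x ∈ P, a x * b x ≤ Real.sqrt A * Real.sqrt B := by
    rw [← Real.sqrt_mul hA0]
    exact (le_abs_self _).trans ((Real.sqrt_sq_eq_abs _).symm.le.trans (Real.sqrt_le_sqrt hcs))
  have hexp : ∑ x ∈ P, (a x + b x) ^ 2 = A + 2 * ∑ x ∈ P, a x * b x + B := by
    rw [hA, hB, mul_sum, ← sum_add_distrib, ← sum_add_distrib]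
    exact sum_congr rfl fun x _ => by ring
  rw [hexp, add_sq, Real.sq_sqrt hA0, Real.sq_sqrt hB0]
  nlinarith [hcross]

omit [Fintype ι] [DecidableEq ι] in
/-- **A SMALL SHIFT OF A SMALL FIELD IS SMALL**: `Σ_Pψ² ≤ Ψ²`, `Σ_Pω² ≤ (h−Ψ)²`, `0 ≤ Ψ ≤ h` ⟹ `Σ_P(ω+ψ)² ≤ h²`. [folklore] -/
theorem small_of_shift_small (P : Finset ι) (ω ψ : EuclideanSpace ℝ ι) {h Ψ : ℝ} (hΨ0 : 0 ≤ Ψ) (hΨh : Ψ ≤ h)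
    (hψ : ∑ x ∈ P, ψ x ^ 2 ≤ Ψ ^ 2) (hω : ∑ x ∈ P, ω x ^ 2 ≤ (h - Ψ) ^ 2) : ∑ x ∈ P, (ω + ψ) x ^ 2 ≤ h ^ 2 := by
  have hsum : ∑ x ∈ P, (ω + ψ) x ^ 2 = ∑ x ∈ P, (ω x + ψ x) ^ 2 :=
    sum_congr rfl fun x _ => by simp only [WithLp.ofLp_add, Pi.add_apply]
  rw [hsum]
  refine (sum_add_sq_le_sq_add P (fun x => ω x) (fun x => ψ x)).trans ?_
  have h1 : Real.sqrt (∑ x ∈ P, ω x ^ 2) ≤ h - Ψ := by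
    rw [← Real.sqrt_sq (by linarith : 0 ≤ h - Ψ)]; exact Real.sqrt_le_sqrt hω
  have h2 : Real.sqrt (∑ x ∈ P, ψ x ^ 2) ≤ Ψ := by
    rw [← Real.sqrt_sq hΨ0]; exact Real.sqrt_le_sqrt hψ
  have h3 : 0 ≤ Real.sqrt (∑ x ∈ P, ω x ^ 2) + Real.sqrt (∑ x ∈ P, ψ x ^ 2) := by positivity
  have h4 : Real.sqrt (∑ x ∈ P, ω x ^ 2) + Real.sqrt (∑ x ∈ P, ψ x ^ 2) ≤ h := by linarith
  exact pow_le_pow_left₀ h3 h4 2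

omit [Fintype ι] [DecidableEq ι] in
/-- … contrapositive: a LARGE shifted field over a small shift comes from a large fluctuation: `h² < Σ_P(ω+ψ)²` ⟹ `(h−Ψ)² < Σ_Pω²`. [folklore] -/
theorem large_of_shift_large (P : Finset ι) (ω ψ : EuclideanSpace ℝ ι) {h Ψ : ℝ} (hΨ0 : 0 ≤ Ψ) (hΨh : Ψ ≤ h)
    (hψ : ∑ x ∈ P, ψ x ^ 2 ≤ Ψ ^ 2) (hlarge : h ^ 2 < ∑ x ∈ P, (ω + ψ) x ^ 2) : (h - Ψ) ^ 2 < ∑ x ∈ P, ω x ^ 2 := by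
  by_contra hω
  exact absurd (small_of_shift_small P ω ψ hΨ0 hΨh hψ (not_lt.1 hω)) (not_le.2 hlarge)

/-! ## §2. The shifted two-letter factor is regulated with a fresh rate -/

omit [Fintype ι] [DecidableEq ι] in
/-- `0 ≤ ε_shift`. [folklore] -/
theorem eps_shift_nonneg {ε M κ₀ κ τ h Ψ : ℝ} (hε : 0 ≤ ε) (hM : 0 ≤ M) :
    0 ≤ ε + M * Real.exp (κ₀ * (1 + τ⁻¹) * Ψ ^ 2 / 2) * Real.exp (-((κ - κ₀ * (1 + τ)) * (h - Ψ) ^ 2 / 2)) := by positivity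

omit [Fintype ι] [DecidableEq ι] in
/-- **THE SHIFTED TWO-LETTER FACTOR IS REGULATED IN THE FLUCTUATION FIELD WITH ANY FRESH RATE.**  On a cell `P`: (S) `‖g(ζ)‖ ≤ ε` for `Σ_Pζ² ≤ h²`;
(L) `‖g(ζ)‖ ≤ M·e^{½κ₀Σ_Pζ²}` for all `ζ`; `0 ≤ ε`, `0 ≤ M`, `0 ≤ κ₀`, `0 < τ`, a fresh rate `κ ≥ κ₀(1+τ)`; an external field with `Σ_Pψ² ≤ Ψ²`,
`0 ≤ Ψ ≤ h` ⟹ for EVERY `ω`: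
`‖g(ω+ψ)‖ ≤ (ε + M·e^{½κ₀(1+τ⁻¹)Ψ²}·e^{−½(κ−κ₀(1+τ))(h−Ψ)²})·e^{½κΣ_Pω²}`. [folklore] -/
theorem twoLetter_shift_regulated (P : Finset ι) {g : EuclideanSpace ℝ ι → ℂ} {ε M κ₀ κ τ h Ψ : ℝ} (hε : 0 ≤ ε) (hM : 0 ≤ M)
    (hκ₀ : 0 ≤ κ₀) (hτ : 0 < τ) (hκ : κ₀ * (1 + τ) ≤ κ)
    (hS : ∀ ζ : EuclideanSpace ℝ ι, ∑ x ∈ P, ζ x ^ 2 ≤ h ^ 2 → ‖g ζ‖ ≤ ε)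
    (hL : ∀ ζ : EuclideanSpace ℝ ι, ‖g ζ‖ ≤ M * Real.exp (κ₀ * (∑ x ∈ P, ζ x ^ 2) / 2))
    (ψ : EuclideanSpace ℝ ι) (hΨ0 : 0 ≤ Ψ) (hΨh : Ψ ≤ h) (hψ : ∑ x ∈ P, ψ x ^ 2 ≤ Ψ ^ 2) (ω : EuclideanSpace ℝ ι) :
    ‖g (ω + ψ)‖ ≤ (ε + M * Real.exp (κ₀ * (1 + τ⁻¹) * Ψ ^ 2 / 2) * Real.exp (-((κ - κ₀ * (1 + τ)) * (h - Ψ) ^ 2 / 2))) *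
      Real.exp (κ * (∑ x ∈ P, ω x ^ 2) / 2) := by
  set s : ℝ := ∑ x ∈ P, ω x ^ 2 with hs
  set pen : ℝ := M * Real.exp (κ₀ * (1 + τ⁻¹) * Ψ ^ 2 / 2) * Real.exp (-((κ - κ₀ * (1 + τ)) * (h - Ψ) ^ 2 / 2)) with hpen
  have hs0 : 0 ≤ s := sum_nonneg fun x _ => sq_nonneg (ω x)
  have hκ0 : 0 ≤ κ := le_trans (by positivity) hκ
  have hE1 : 1 ≤ Real.exp (κ * s / 2) := one_le_exp (by positivity)
  have hpen0 : 0 ≤ pen := by positivity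
  by_cases hsm : ∑ x ∈ P, (ω + ψ) x ^ 2 ≤ h ^ 2
  · -- small shifted field: letter (S), no cost
    calc ‖g (ω + ψ)‖ ≤ ε := hS _ hsm
      _ ≤ ε + pen := by linarith
      _ ≤ (ε + pen) * Real.exp (κ * s / 2) := le_mul_of_one_le_right (by positivity) hE1
  · -- large shifted field: the fluctuation is large, letter (L) + Young at the small rate + conversion at the fresh rate
    have hlarge := large_of_shift_large P ω ψ hΨ0 hΨh hψ (not_le.1 hsm)
    have hsumY : ∑ x ∈ P, (ω + ψ) x ^ 2 ≤ (1 + τ) * s + (1 + τ⁻¹) * ∑ x ∈ P, ψ x ^ 2 := by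
      have hsum : ∑ x ∈ P, (ω + ψ) x ^ 2 = ∑ x ∈ P, (ω x + ψ x) ^ 2 :=
        sum_congr rfl fun x _ => by simp only [WithLp.ofLp_add, Pi.add_apply]
      rw [hsum]; exact sum_add_sq_le P (fun x => ω x) (fun x => ψ x) hτ
    have h1 : κ₀ * (∑ x ∈ P, (ω + ψ) x ^ 2) / 2 ≤ κ₀ * (1 + τ⁻¹) * Ψ ^ 2 / 2 + κ₀ * (1 + τ) * s / 2 := by
      have h1a := mul_le_mul_of_nonneg_left hsumY hκ₀
      have h1b : 0 ≤ κ₀ * (1 + τ⁻¹) := by positivity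
      have h1c := mul_le_mul_of_nonneg_left hψ h1b
      nlinarith
    -- conversion: `κ₀(1+τ)s/2 ≤ −(κ−κ₀(1+τ))(h−Ψ)²/2 + κ s/2` since `(h−Ψ)² < s` and `κ ≥ κ₀(1+τ)`
    have h2 : κ₀ * (1 + τ) * s / 2 ≤ -((κ - κ₀ * (1 + τ)) * (h - Ψ) ^ 2 / 2) + κ * s / 2 := by
      have := mul_le_mul_of_nonneg_left hlarge.le (sub_nonneg.2 hκ)
      nlinarith
    calc ‖g (ω + ψ)‖ ≤ M * Real.exp (κ₀ * (∑ x ∈ P, (ω + ψ) x ^ 2) / 2) := hL _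
      _ ≤ M * Real.exp (κ₀ * (1 + τ⁻¹) * Ψ ^ 2 / 2 + (-((κ - κ₀ * (1 + τ)) * (h - Ψ) ^ 2 / 2) + κ * s / 2)) :=
          mul_le_mul_of_nonneg_left (exp_le_exp.2 (by linarith)) hM
      _ = pen * Real.exp (κ * s / 2) := by rw [hpen, Real.exp_add, Real.exp_add]; ring
      _ ≤ (ε + pen) * Real.exp (κ * s / 2) := by nlinarith [Real.exp_pos (κ * s / 2)]

/-! ## §3. The window without doubling -/

omit [Fintype ι] [DecidableEq ι] in
/-- **THE WINDOW IS A CONDITION ON THE RADIUS, NOT ON AN INHERITED RATE**: `0 < ε`, `0 < M`,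
`log(M∕ε) + ½κ₀(1+τ⁻¹)Ψ² ≤ ½(κ−κ₀(1+τ))(h−Ψ)²` ⟹ `ε_shift ≤ 2ε`. [folklore] -/
theorem eps_shift_le_two_eps {ε M κ₀ κ τ h Ψ : ℝ} (hε : 0 < ε) (hM : 0 < M)
    (hwin : Real.log (M / ε) + κ₀ * (1 + τ⁻¹) * Ψ ^ 2 / 2 ≤ (κ - κ₀ * (1 + τ)) * (h - Ψ) ^ 2 / 2) :
    ε + M * Real.exp (κ₀ * (1 + τ⁻¹) * Ψ ^ 2 / 2) * Real.exp (-((κ - κ₀ * (1 + τ)) * (h - Ψ) ^ 2 / 2)) ≤ 2 * ε := by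
  have h1 : M * Real.exp (κ₀ * (1 + τ⁻¹) * Ψ ^ 2 / 2) * Real.exp (-((κ - κ₀ * (1 + τ)) * (h - Ψ) ^ 2 / 2)) =
      M * Real.exp (κ₀ * (1 + τ⁻¹) * Ψ ^ 2 / 2 - (κ - κ₀ * (1 + τ)) * (h - Ψ) ^ 2 / 2) := by
    rw [mul_assoc, ← Real.exp_add]; ring_nf
  have h2 : Real.exp (κ₀ * (1 + τ⁻¹) * Ψ ^ 2 / 2 - (κ - κ₀ * (1 + τ)) * (h - Ψ) ^ 2 / 2) ≤ ε / M := by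
    have h3 : κ₀ * (1 + τ⁻¹) * Ψ ^ 2 / 2 - (κ - κ₀ * (1 + τ)) * (h - Ψ) ^ 2 / 2 ≤ Real.log (ε / M) := by
      have : Real.log (ε / M) = -Real.log (M / ε) := by rw [← Real.log_inv, inv_div]
      linarith
    calc Real.exp (κ₀ * (1 + τ⁻¹) * Ψ ^ 2 / 2 - (κ - κ₀ * (1 + τ)) * (h - Ψ) ^ 2 / 2) ≤ Real.exp (Real.log (ε / M)) := exp_le_exp.2 h3
      _ = ε / M := Real.exp_log (by positivity)
  rw [h1]
  have h4 : M * Real.exp (κ₀ * (1 + τ⁻¹) * Ψ ^ 2 / 2 - (κ - κ₀ * (1 + τ)) * (h - Ψ) ^ 2 / 2) ≤ M * (ε / M) :=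
    mul_le_mul_of_nonneg_left h2 hM.le
  rw [mul_div_cancel₀ _ hM.ne'] at h4
  linarith

/-! ## §4. The activity letter with the fresh rate -/

/-- **THE ACTIVITY LETTER OF SHIFTED TWO-LETTER FACTORS, WITH THE FRESH RATE**: `Γ ⪰ 0`, `Γ ⪯ γ_op·1`, diagonal `≤ γ` (`γ ≥ 0`); disjoint cells of
`≤ v` sites; every cell factor two-lettered (`(S)` with radius `h`, `(L)` with `M`, `κ₀`); `0 < τ`, a fresh rate `κ ≥ κ₀(1+τ)` SUBCRITICAL FOR THIS
GAUSSIAN (`κγ_op ≤ θ < 1`, `0 < θ`); the external field with `Σ_{cell p}ψ² ≤ Ψ²` on every cell, `0 ≤ Ψ ≤ h` ⟹ for every finite `K`: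
`‖∫∏_{p∈K}g_p(ω+ψ)dN(0,Γ)(ω)‖ ≤ (ε_shift·A^v)^{#K}`, `A = (1−θ)^{−κγ∕(2θ)}`. [folklore] -/
theorem twoLetter_activity_le [DecidableEq V] {Γ : Matrix ι ι ℝ} {γop γ : ℝ} (hΓ : Γ.PosSemidef)
    (hΓop : (γop • (1 : Matrix ι ι ℝ) - Γ).PosSemidef) (hdiag : ∀ i, Γ i i ≤ γ) (hγ : 0 ≤ γ) (cell : V → Finset ι)
    (hdisj : ∀ p q, p ≠ q → Disjoint (cell p) (cell q)) {v : ℕ} (hv : ∀ p, (cell p).card ≤ v)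
    {g : V → EuclideanSpace ℝ ι → ℂ} {ε M κ₀ κ τ θ h Ψ : ℝ} (hε : 0 ≤ ε) (hM : 0 ≤ M) (hκ₀ : 0 ≤ κ₀) (hτ : 0 < τ)
    (hκ : κ₀ * (1 + τ) ≤ κ) (hθ0 : 0 < θ) (hθ1 : θ < 1) (hκθ : κ * γop ≤ θ)
    (hS : ∀ p (ζ : EuclideanSpace ℝ ι), ∑ x ∈ cell p, ζ x ^ 2 ≤ h ^ 2 → ‖g p ζ‖ ≤ ε)
    (hL : ∀ p (ζ : EuclideanSpace ℝ ι), ‖g p ζ‖ ≤ M * Real.exp (κ₀ * (∑ x ∈ cell p, ζ x ^ 2) / 2))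
    (ψ : EuclideanSpace ℝ ι) (hΨ0 : 0 ≤ Ψ) (hΨh : Ψ ≤ h) (hψ : ∀ p, ∑ x ∈ cell p, ψ x ^ 2 ≤ Ψ ^ 2) (K : Finset V) :
    ‖cellActivity (multivariateGaussian 0 Γ) (fun p ω => g p (ω + ψ)) K‖ ≤
      ((ε + M * Real.exp (κ₀ * (1 + τ⁻¹) * Ψ ^ 2 / 2) * Real.exp (-((κ - κ₀ * (1 + τ)) * (h - Ψ) ^ 2 / 2))) *
        ((1 - θ) ^ (-(κ * γ / (2 * θ)))) ^ v) ^ K.card :=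
  norm_cellActivity_le_of_regulated hΓ hΓop hdiag hγ cell hdisj hv (eps_shift_nonneg hε hM) (le_trans (by positivity) hκ) hθ0 hθ1 hκθ
    (fun p ω => twoLetter_shift_regulated (cell p) hε hM hκ₀ hτ hκ (hS p) (hL p) ψ hΨ0 hΨh (hψ p) ω) K

/-! ## §5. Toy -/

omit [Fintype ι] [DecidableEq ι] in
/-- Toy (§1): on the empty cell every field is small (`0 ≤ h²`). -/
example (ω ψ : EuclideanSpace ℝ ι) {h Ψ : ℝ} (hΨ0 : 0 ≤ Ψ) (hΨh : Ψ ≤ h) :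
    ∑ x ∈ (∅ : Finset ι), (ω + ψ) x ^ 2 ≤ h ^ 2 :=
  small_of_shift_small ∅ ω ψ hΨ0 hΨh (by simp; positivity) (by simp; positivity)

end Summit.QuantumFields.BalabanUV.T4Continuum.NE7b.SupTwoLetterShift
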